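import Literature.MathematicalPhysics.QuantumLattice.HubbardCorrelatorCertificate
import Literature.MathematicalPhysics.QuantumLattice.HubbardWindowCertificateAffine
import Literature.MathematicalPhysics.QuantumLattice.HubbardChainEnergyDensity
import Literature.MathematicalPhysics.QuantumLattice.InfVolFermionStateCompactness
import Literature.MathematicalPhysics.QuantumLattice.HubbardLangerMattisTorus
import HarnessLib

/-!
# Correlator certificates with an energy constraint in every dimension (affine reductions
# `x ↦ εx + v`); the half-filled Hubbard chain

Family `hubbard` (topic `MathematicalPhysics/QuantumLattice`). Companion of
`HubbardCorrelatorCertificate` (square lattice, affine `D₄` reductions). Here the symmetry family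
of the window identity is, in every dimension `d`, the group `{±1} ⋉ ℤ^d` of affine maps
`x ↦ εx + v` (the reductions of `HubbardWindowCertificateAffine`; for the chain `d = 1` this is the
full space group, used by the bundle's one-dimensional correlator certificates
`hubTL_w*_U*_…_D{lo,up}` of papers/HubbardSuperconductivity/manybody-bootstrap/, format `certsdp/1`
§6–§7). The method is Wang–Surace–Frérot–Legat–Renou–Magron–Acín, PRX 14 (2024) 031006, §III
(the energy constraint `⟨E_up·1 − H⟩ ≥ 0` with a certified upper bound added to the relaxation of
a ground-state observable) in Han's translation-invariant form (arXiv:2006.06002 §2–3):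

* `re_projState_ge_of_window_certificate_aff_ineq` — the window identity with energy-constraint
  term `κ (u·1 − Γ(incl) E_Φ)`, pulled back into every large torus `(ℤ/Lℤ)^d`, bounds the
  expectation of the objective in the tracial ground state of the sector `(2n, S^z = 0)` with the
  explicit slack `κ (u − E₀(2n)/L^d)`;
* Lieb's theorem on the even torus in EVERY dimension `d ≥ 1` (the two sublattices of the
  staggering sign are equinumerous, `LiebHalfFilled.two_mul_card_filter_torusStagger_eq_one_pow`; `|(ℤ/Lℤ)^d| = L^d` is `LangerMattis.card_fermionTorus_eq`):
  THE half-filled ground state and the instance-robust bridge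
  `LiebHalfFilled.hubbardTorus_groundState_expect_eq_projState_pow`;
* `groundState_re_expect_ge_of_window_certificate_aff_ineq` /
  `groundState_re_torusAvgExpectAt_ge_of_window_certificate_aff_ineq` — the bound for every
  normalised half-filled ground-state vector of every large even torus;
* `InfVolFermionState.IsTorusLimitOf.re_expect_ge_of_chain_window_certificate_ineq` — the
  thermodynamic limit for the CHAIN: every torus-limit ground state `ω` of the half-filled Hubbard
  chain satisfies `c − Σₖ ‖aₖ‖ + (Σ_σ μ_σ)(1/2 − ν) ≤ Re ω(X)` once
  `hubbardChainEnergyDensity t U ≤ u` (`κ ≥ 0`); such `ω` exist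
  (`LiebHalfFilled.exists_isTorusLimitOf_groundState_pow`);
* the energy hypothesis is about `ω` itself: torus-limit half-filled ground states have
  `ω.hubbardEnergyDensity t U = energyDensity2D t U 1` (square lattice, even `L`) resp.
  `= hubbardChainEnergyDensity t U` (chain)
  (`InfVolFermionState.IsTorusLimitOf.hubbardEnergyDensity_eq_energyDensity2D_of_isGroundState`,
  `….hubbardEnergyDensity_eq_hubbardChainEnergyDensity`; cf. the sector form
  `IsTorusLimitOf.hubbardEnergyDensity_eq_energyDensity2D` of InfVolFermionStateHubbardEnergy);
* double occupancy ↔ slope of the energy density (Koma–Tasaki: order parameters are one-sided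
  derivatives of the ground-state energy density): the chain supergradient inequality
  `e_chain(t,U') − e_chain(t,U) ≤ (U' − U)·Re ω(n_{0↑}n_{0↓})` for torus-limit half-filled chain
  ground states (`DoubleOccupancy.hubbardChainEnergyDensity_sub_le_mul_of_tendsto`,
  `IsTorusLimitOf.hubbardChainEnergyDensity_sub_le_mul_re_expect_docc`; the square-lattice form is
  `IsTorusLimitOf.energyDensity2D_sub_le_mul_re_expect_docc` of `HubbardCorrelatorCertificate`), and
  MONOTONICITY: the double occupancy of torus-limit ground states is non-increasing in `U`
  (`IsTorusLimitOf.re_expect_docc_anti`, `…_halfFilled`, `…_chain`), so certified lower bounds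
  transport to smaller `U` and certified upper bounds to larger `U`.

Everything is PROVED; no definition, no named fact.

## References
* J. Wang et al., *Certifying ground-state properties of many-body systems*, Phys. Rev. X 14
  (2024) 031006, §III. [cite: WangEtAl2024, §III]
* X. Han, *Quantum many-body bootstrap*, arXiv:2006.06002 (2020), §2–3. [cite: Han2020Bootstrap, §2–3]
* E. H. Lieb, PRL 62 (1989) 1201, Theorem 2. [cite: LiebPRL1989, Theorem 2]
* O. Bratteli, D. W. Robinson, *Operator Algebras and Quantum Statistical Mechanics II*, 2nd ed.,
  §6.2.4. [cite: BratteliRobinsonII1997, §6.2.4]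
* T. Koma, H. Tasaki, *Symmetry breaking and finite-size effects in quantum many-body systems*,
  J. Stat. Phys. 76 (1994) 745, §1. [cite: KomaTasaki1994, §1]
-/

noncomputable section

namespace Literature.MathematicalPhysics.QuantumLattice

open Matrix Finset HubbardWave0 Literature.Probability.LatticeModels
open Literature.MathematicalPhysics.QuantumManyBody.StateRelaxation
open scoped ComplexOrder BigOperators

/-! ### The window certificate with an energy constraint, affine reductions, every `d` -/

section Window

variable {d L : ℕ} [NeZero L]

/-- (Local to this file, as in `HubbardWindowCertificateAffine`.) [folklore] -/
local instance (priority := high) instDecidableEqFermionTorusCorrAff : DecidableEq (FermionTorus d L) :=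
  LinearOrder.toDecidableEq

/-- **Window certificate with an energy constraint and affine reductions ⇒ ground-state
expectation of a local observable on every large torus** (every `d`). As
`re_projState_ge_of_window_certificate_d4_ineq` (HubbardCorrelatorCertificate) with the symmetry
family `x ↦ εₗx + vₗ` of `groundEnergyAt_div_ge_of_window_certificate_aff`: the window identity
`X − c·1 − Σ_σ μ_σ (n_{0σ} − ν·1) − κ (u·1 − Γ(incl) E_Φ) = Σ Λₐᵦ Oₐᴴ O_b + (Σₖ (H_{Λ'} Bₖ − Bₖ H_{Λ'})
   + Σₗ (Γ(incl)(Γ(affEmb εₗ vₗ) Yₗ) − Γ(incl) Yₗ) + Σⱼ bⱼ • wⱼ) + (Σₘ dₘ • (Vₘᴴ − Vₘ) + Σₖ aₖ • vₖ)`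
proves, for every `L ≥ 3` with `x ↦ x mod L` injective on `thicken Λ' 1` and every `n ≤ L^d`,
`c − Σₖ ‖aₖ‖ + (Σ_σ μ_σ)(n/L^d − ν) + κ (u − groundEnergyAt (fermionTorusGraph d L) t U (2n)/L^d)
   ≤ Re ω_P(Γ(ι_{Λ',L}) X)` in the tracial ground state `ω_P` of the sector `(2n, S^z = 0)`.
[cite: WangEtAl2024, §III] -/
theorem re_projState_ge_of_window_certificate_aff_ineq (t U : ℝ) (hL : 3 ≤ L) {nh : ℕ}
    (hn : nh ≤ Fintype.card (FermionTorus d L))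
    {Λ Λ' : Finset (Site d)} (hΛ : Λ ⊆ Λ')
    (hclosed : ∀ x ∈ Λ, ∀ i : Fin d, x + unitVec i ∈ Λ' ∧ x - unitVec i ∈ Λ')
    (h0 : thicken ({0} : Finset (Site d)) 1 ⊆ Λ') (hz : (0 : Site d) ∈ Λ')
    (hInj : Set.InjOn (Torus.proj (d := d) L) ↑(thicken Λ' 1))
    (hInj' : Set.InjOn (Torus.proj (d := d) L) ↑Λ')
    (Xw : FermionOp Λ') (κ u : ℝ) (μ : Fin 2 → ℝ) (ν : ℝ)
    {m : Type*} [Fintype m] [DecidableEq m] {Λm : Matrix m m ℂ} (hΛm : Λm.PosSemidef)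
    (O : m → FermionOp Λ')
    {κ' : Type*} (s : Finset κ') (B : κ' → FermionOp Λ)
    {ι : Type*} (tt : Finset ι) (ε : ι → ℤˣ) (vv : ι → Site d) (hsh : ∀ l, affShiftSet (ε l) (vv l) Λ ⊆ Λ')
    (Y : ι → FermionOp Λ)
    {ρ : Type*} (uu : Finset ρ) (b : ρ → ℂ) (cw : ρ → List (Orb (PolySite Λ') × Bool))
    (hcw : ∀ j ∈ uu, ladderCharge (cw j) ≠ 0 ∨ ladderSpinCharge (cw j) ≠ 0)
    {δ : Type*} (ah : Finset δ) (dc : δ → ℝ) (V : δ → FermionOp Λ')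
    {κ'' : Type*} (w : Finset κ'') (a : κ'' → ℂ) (word : κ'' → List (Orb (PolySite Λ') × Bool)) {c : ℝ}
    (hcert : Xw - (c : ℂ) • (1 : FermionOp Λ') -
        ∑ σ : Fin 2, ((μ σ : ℝ) : ℂ) • (nAt 0 hz σ - ((ν : ℝ) : ℂ) • (1 : FermionOp Λ')) -
        ((κ : ℝ) : ℂ) • (((u : ℝ) : ℂ) • (1 : FermionOp Λ') -
          fermionEmbed (PolySite.incl h0) ((hubbardFermionInteraction d t U).meanEnergyObs 1)) =
      gramForm Λm O +
        (∑ k ∈ s, ((hubbardFermionInteraction d t U).localHamiltonian Λ' * fermionEmbed (PolySite.incl hΛ) (B k) -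
            fermionEmbed (PolySite.incl hΛ) (B k) * (hubbardFermionInteraction d t U).localHamiltonian Λ') +
          ∑ l ∈ tt, (fermionEmbed (PolySite.incl (hsh l)) (fermionEmbed (PolySite.affEmb (ε l) (vv l) Λ) (Y l)) -
            fermionEmbed (PolySite.incl hΛ) (Y l)) +
          ∑ j ∈ uu, b j • ladderWord (cw j)) +
        (∑ m' ∈ ah, ((dc m' : ℝ) : ℂ) • ((V m')ᴴ - V m') + ∑ k ∈ w, a k • ladderWord (word k))) :
    c - ∑ k ∈ w, ‖a k‖ + (∑ σ : Fin 2, μ σ) * ((nh : ℝ) / (L : ℝ) ^ d - ν) +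
        κ * (u - groundEnergyAt (fermionTorusGraph d L) t U (2 * nh) / (L : ℝ) ^ d) ≤
      (((hubbardTorus d L t U).sectorGroundProj (szSector (2 * nh) 0)).projState
        (fermionEmbed (PolySite.toTorusEmb L hInj') Xw)).re := by
  have hInjΛ : Set.InjOn (Torus.proj (d := d) L) ↑Λ := hInj'.mono (by exact_mod_cast hΛ)
  have hInj0 : Set.InjOn (Torus.proj (d := d) L) ↑(thicken ({0} : Finset (Site d)) 1) :=
    hInj'.mono (by exact_mod_cast h0)
  set Γ' := fermionEmbed (PolySite.toTorusEmb L hInj') with hΓ'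
  set ΓΛ := fermionEmbed (PolySite.toTorusEmb L hInjΛ) with hΓΛ
  set H := hubbardTorus d L t U with hH
  set EΦ := (hubbardFermionInteraction d t U).meanEnergyObs 1 with hEΦ
  set X := Γ' (fermionEmbed (PolySite.incl h0) EΦ) with hX
  have hX0 : X = fermionEmbed (PolySite.toTorusEmb L hInj0) EΦ := fermionEmbed_toTorusEmb_incl h0 hInj' EΦ
  have hsum : ∑ v' : TorusSite d L, (fockTranslate v').val * X * (fockTranslate v').valᴴ = H := by
    rw [hX0]
    have h := sum_relabel_translate_hubbard_meanEnergyObs (d := d) t U hL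
    simp_rw [relabel_eq_fockRelabel_conj] at h
    exact h
  set D : Fin 2 → Matrix (Finset (Orb (FermionTorus d L))) (Finset (Orb (FermionTorus d L))) ℂ :=
    fun σ => numberOp (FermionTorus.ofTorusSite (0 : TorusSite d L)) σ with hD
  set G : Fin 2 → Matrix (Finset (Orb (FermionTorus d L))) (Finset (Orb (FermionTorus d L))) ℂ :=
    fun σ => ∑ y : FermionTorus d L, numberOp y σ with hG
  have hDΓ : ∀ σ, Γ' (nAt 0 hz σ) = D σ := fun σ => fermionEmbed_toTorusEmb_nAt_zero hz hInj' σ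
  have hDsum : ∀ σ ∈ (Finset.univ : Finset (Fin 2)),
      ∑ v' : TorusSite d L, (fockTranslate v').val * D σ * (fockTranslate v').valᴴ = G σ :=
    fun σ _ => sum_conj_fockTranslate_numberOp 0 σ
  have hGh : ∀ σ ∈ (Finset.univ : Finset (Fin 2)), (G σ).IsHermitian := fun σ _ => isHermitian_sum_numberOp σ
  have hGs : ∀ σ ∈ (Finset.univ : Finset (Fin 2)),
      ∀ ψ ∈ (szSector (2 * nh) 0 : Submodule ℂ (Fock (Orb (FermionTorus d L)))),
        G σ *ᵥ ψ = (((nh : ℝ) : ℝ) : ℂ) • ψ := by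
    intro σ _ ψ hψ
    rw [hG, spinNumber_mulVec_of_mem_szSector σ hψ]
    congr 1
    push_cast
    ring
  -- symmetry family: affine maps `x ↦ εx + v`
  set Us : ι → Matrix (Finset (Orb (FermionTorus d L))) (Finset (Orb (FermionTorus d L))) ℂ :=
    fun l => (fockAff (ε l) (Torus.proj L (vv l))).val with hUs
  set Yt : ι → Matrix (Finset (Orb (FermionTorus d L))) (Finset (Orb (FermionTorus d L))) ℂ :=
    fun l => ΓΛ (Y l) with hYt
  have hU : ∀ l ∈ tt, Us l * H = H * Us l := fun l _ => fockAff_mul_hubbardTorus _ _ t U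
  have hUK : ∀ l ∈ tt, ∀ ψ ∈ (szSector (2 * nh) 0 : Submodule ℂ (Fock (Orb (FermionTorus d L)))),
      Us l *ᵥ ψ ∈ (szSector (2 * nh) 0 : Submodule ℂ (Fock (Orb (FermionTorus d L)))) :=
    fun l _ ψ hψ => fockAff_mulVec_mem_szSector _ _ hψ
  have hUK' : ∀ l ∈ tt, ∀ ψ ∈ (szSector (2 * nh) 0 : Submodule ℂ (Fock (Orb (FermionTorus d L)))),
      (Us l)ᴴ *ᵥ ψ ∈ (szSector (2 * nh) 0 : Submodule ℂ (Fock (Orb (FermionTorus d L)))) :=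
    fun l _ ψ hψ => fockAff_conjTranspose_mulVec_mem_szSector _ _ hψ
  have hUU : ∀ l ∈ tt, (Us l)ᴴ * Us l = 1 := fun l _ => fockAff_conjTranspose_mul_self _ _
  -- charge family
  set emb : Orb (PolySite Λ') × Bool → Orb (FermionTorus d L) × Bool :=
    fun p => (Orb.embMap (PolySite.toTorusEmb L hInj') p.1, p.2) with hemb
  set C : ρ → Matrix (Finset (Orb (FermionTorus d L))) (Finset (Orb (FermionTorus d L))) ℂ :=
    fun j => if ladderCharge ((cw j).map emb) ≠ 0 then totalNumber else HubbardWave0.spinZ with hC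
  set W : ρ → Matrix (Finset (Orb (FermionTorus d L))) (Finset (Orb (FermionTorus d L))) ℂ :=
    fun j => (b j / (if ladderCharge ((cw j).map emb) ≠ 0 then ((ladderCharge ((cw j).map emb) : ℤ) : ℂ)
      else ((ladderSpinCharge ((cw j).map emb) : ℤ) : ℂ) / 2)) • ladderWord ((cw j).map emb) with hW
  have hHc := hamiltonian_isHermitian_and_commute_holds (fermionTorusGraph d L) t U
  have hC1 : ∀ j ∈ uu, C j * H = H * C j := by
    intro j _
    by_cases hq : ladderCharge ((cw j).map emb) ≠ 0
    · simp only [hC, hq, ne_eq, not_false_eq_true, if_true]; exact hHc.2.1.symm.eq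
    · simp only [hC, hq, if_false]; exact hHc.2.2.symm.eq
  have hCK : ∀ j ∈ uu, ∀ ψ ∈ (szSector (2 * nh) 0 : Submodule ℂ (Fock (Orb (FermionTorus d L)))),
      C j *ᵥ ψ ∈ (szSector (2 * nh) 0 : Submodule ℂ (Fock (Orb (FermionTorus d L)))) := by
    intro j _ ψ hψ
    obtain ⟨hNψ, hSψ⟩ := (mem_szSector_iff _ _ ψ).1 hψ
    by_cases hq : ladderCharge ((cw j).map emb) ≠ 0
    · simp only [hC, hq, ne_eq, not_false_eq_true, if_true]
      rw [totalNumber_mulVec_of_isNParticle hNψ]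
      exact Submodule.smul_mem _ _ hψ
    · simp only [hC, hq, if_false]
      rw [hSψ]
      exact Submodule.smul_mem _ _ hψ
  have hCh : ∀ j, (C j)ᴴ = C j := by
    intro j
    by_cases hq : ladderCharge ((cw j).map emb) ≠ 0
    · simp only [hC, hq, ne_eq, not_false_eq_true, if_true]
      rw [totalNumber_eq_numberDiag_univ]
      exact numberDiag_conjTranspose _
    · simp only [hC, hq, if_false]; exact HubbardWave0.spinZ_isHermitian.eq
  have hCK' : ∀ j ∈ uu, ∀ ψ ∈ (szSector (2 * nh) 0 : Submodule ℂ (Fock (Orb (FermionTorus d L)))),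
      (C j)ᴴ *ᵥ ψ ∈ (szSector (2 * nh) 0 : Submodule ℂ (Fock (Orb (FermionTorus d L)))) :=
    fun j hj ψ hψ => by rw [hCh j]; exact hCK j hj ψ hψ
  have hcharged : ∀ j ∈ uu, Γ' (b j • ladderWord (cw j)) = C j * W j - W j * C j := by
    intro j hj
    rw [map_smul, hΓ', fermionEmbed_ladderWord]
    have hl : ladderCharge ((cw j).map emb) ≠ 0 ∨ ladderSpinCharge ((cw j).map emb) ≠ 0 := by
      rw [hemb, ladderCharge_map_embMap, ladderSpinCharge_map_embMap]; exact hcw j hj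
    exact smul_ladderWord_eq_commutator_of_charged (b j) _ hl
  -- residual words
  set M : κ'' → Matrix (Finset (Orb (FermionTorus d L))) (Finset (Orb (FermionTorus d L))) ℂ :=
    fun k => ladderWord ((word k).map emb) with hM
  have hMc : ∀ k ∈ w, (M k).IsContraction := fun k _ => by
    rw [hM]; dsimp only; rw [ladderWord_eq_prod]; exact isContraction_prod_ladder _
  -- the left-hand side, pulled back into the torus
  have hlhs : Γ' (Xw - (c : ℂ) • (1 : FermionOp Λ') -
        ∑ σ : Fin 2, ((μ σ : ℝ) : ℂ) • (nAt 0 hz σ - ((ν : ℝ) : ℂ) • (1 : FermionOp Λ')) -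
        ((κ : ℝ) : ℂ) • (((u : ℝ) : ℂ) • (1 : FermionOp Λ') - fermionEmbed (PolySite.incl h0) EΦ)) =
      Γ' Xw - (c : ℂ) • (1 : Matrix (Finset (Orb (FermionTorus d L))) (Finset (Orb (FermionTorus d L))) ℂ) -
        ∑ σ ∈ (Finset.univ : Finset (Fin 2)), ((μ σ : ℝ) : ℂ) • (D σ - ((ν : ℝ) : ℂ) •
          (1 : Matrix (Finset (Orb (FermionTorus d L))) (Finset (Orb (FermionTorus d L))) ℂ)) -
        ((κ : ℝ) : ℂ) • (((u : ℝ) : ℂ) •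
          (1 : Matrix (Finset (Orb (FermionTorus d L))) (Finset (Orb (FermionTorus d L))) ℂ) - X) := by
    have hs : Γ' (∑ σ : Fin 2, ((μ σ : ℝ) : ℂ) • (nAt 0 hz σ - ((ν : ℝ) : ℂ) • (1 : FermionOp Λ'))) =
        ∑ σ ∈ (Finset.univ : Finset (Fin 2)), ((μ σ : ℝ) : ℂ) • (D σ - ((ν : ℝ) : ℂ) •
          (1 : Matrix (Finset (Orb (FermionTorus d L))) (Finset (Orb (FermionTorus d L))) ℂ)) := by
      rw [map_sum]
      exact Finset.sum_congr rfl fun σ _ => by rw [map_smul, map_sub, map_smul, map_one, hDΓ]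
    have hk : Γ' (((κ : ℝ) : ℂ) • (((u : ℝ) : ℂ) • (1 : FermionOp Λ') - fermionEmbed (PolySite.incl h0) EΦ)) =
        ((κ : ℝ) : ℂ) • (((u : ℝ) : ℂ) •
          (1 : Matrix (Finset (Orb (FermionTorus d L))) (Finset (Orb (FermionTorus d L))) ℂ) - X) := by
      rw [map_smul, map_sub, map_smul, map_one, hX]
    rw [map_sub, hk, map_sub, hs, map_sub, map_smul, map_one]
  -- the identity, pulled back into the torus
  have htorus : Γ' Xw - (c : ℂ) • (1 : Matrix (Finset (Orb (FermionTorus d L))) (Finset (Orb (FermionTorus d L))) ℂ) -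
      ∑ σ ∈ (Finset.univ : Finset (Fin 2)), ((μ σ : ℝ) : ℂ) • (D σ - ((ν : ℝ) : ℂ) •
        (1 : Matrix (Finset (Orb (FermionTorus d L))) (Finset (Orb (FermionTorus d L))) ℂ)) -
      ((κ : ℝ) : ℂ) • (((u : ℝ) : ℂ) •
        (1 : Matrix (Finset (Orb (FermionTorus d L))) (Finset (Orb (FermionTorus d L))) ℂ) - X) =
      gramForm Λm (fun i => Γ' (O i)) +
        (∑ k ∈ s, (H * Γ' (fermionEmbed (PolySite.incl hΛ) (B k)) - Γ' (fermionEmbed (PolySite.incl hΛ) (B k)) * H) +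
          ∑ l ∈ tt, (Us l * Yt l * (Us l)ᴴ - Yt l) +
          ∑ i ∈ (∅ : Finset (Fin 0)), ((0 : Matrix _ _ ℂ) * ((0 : Matrix _ _ ℂ) - (((0 : ℝ) : ℝ) : ℂ) • 1) +
            ((0 : Matrix _ _ ℂ) - (((0 : ℝ) : ℝ) : ℂ) • 1) * (0 : Matrix _ _ ℂ)) +
          ∑ j ∈ uu, (C j * W j - W j * C j)) +
        (∑ m' ∈ ah, ((dc m' : ℝ) : ℂ) • ((Γ' (V m'))ᴴ - Γ' (V m')) + ∑ k ∈ w, a k • M k) := by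
    have key := congrArg Γ' hcert
    rw [hlhs] at key
    have h1 : Γ' (∑ k ∈ s, ((hubbardFermionInteraction d t U).localHamiltonian Λ' * fermionEmbed (PolySite.incl hΛ) (B k) -
        fermionEmbed (PolySite.incl hΛ) (B k) * (hubbardFermionInteraction d t U).localHamiltonian Λ')) =
        ∑ k ∈ s, (H * Γ' (fermionEmbed (PolySite.incl hΛ) (B k)) - Γ' (fermionEmbed (PolySite.incl hΛ) (B k)) * H) := by
      rw [map_sum]
      refine Finset.sum_congr rfl fun k _ => ?_
      rw [hH, hΓ', hubbardTorus_commutator_fermionEmbed L t U hΛ hclosed hInj (B k)]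
    have h2 : Γ' (∑ l ∈ tt, (fermionEmbed (PolySite.incl (hsh l)) (fermionEmbed (PolySite.affEmb (ε l) (vv l) Λ) (Y l)) -
        fermionEmbed (PolySite.incl hΛ) (Y l))) = ∑ l ∈ tt, (Us l * Yt l * (Us l)ᴴ - Yt l) := by
      rw [map_sum]
      refine Finset.sum_congr rfl fun l _ => ?_
      rw [hUs, hYt, hΓΛ, hΓ']
      exact fermionEmbed_toTorusEmb_aff_sub hΛ (ε l) (vv l) (hsh l) hInj' (Y l)
    have h3 : Γ' (∑ j ∈ uu, b j • ladderWord (cw j)) = ∑ j ∈ uu, (C j * W j - W j * C j) := by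
      rw [map_sum]
      exact Finset.sum_congr rfl hcharged
    have h4 : Γ' (∑ m' ∈ ah, ((dc m' : ℝ) : ℂ) • ((V m')ᴴ - V m')) =
        ∑ m' ∈ ah, ((dc m' : ℝ) : ℂ) • ((Γ' (V m'))ᴴ - Γ' (V m')) := by
      rw [map_sum]
      refine Finset.sum_congr rfl fun m' _ => ?_
      rw [map_smul, map_sub, hΓ', fermionEmbed_conjTranspose]
    have h5 : Γ' (∑ k ∈ w, a k • ladderWord (word k)) = ∑ k ∈ w, a k • M k := by
      rw [map_sum]
      refine Finset.sum_congr rfl fun k _ => ?_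
      rw [map_smul, hM, hΓ', fermionEmbed_ladderWord]
    rw [key, map_add, map_add, map_add, map_add, map_add, hΓ', fermionEmbed_gramForm, ← hΓ', h1, h2, h3, h4, h5,
      Finset.sum_empty, add_zero]
  have hmain := hubbardTorus_re_projState_ge_of_local_certificate_ineq t U hn (Γ' Xw) X hsum κ u
    (Finset.univ : Finset (Fin 2)) μ (fun _ => ν) (fun _ => (nh : ℝ)) D G hDsum hGh hGs hΛm
    (fun i => Γ' (O i)) s (fun k => Γ' (fermionEmbed (PolySite.incl hΛ) (B k))) tt Us Yt hU hUK hUK' hUU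
    (∅ : Finset (Fin 0)) (fun _ => 0) (fun _ => 0) (fun _ => 0) (fun _ => 0)
    (fun i hi => absurd hi (Finset.notMem_empty i)) (fun i hi => absurd hi (Finset.notMem_empty i))
    uu C W hC1 hCK hCK' ah dc (fun m' => Γ' (V m')) w a M hMc htorus
  have hs : ∑ σ ∈ (Finset.univ : Finset (Fin 2)), μ σ * ((nh : ℝ) / (L : ℝ) ^ d - ν) =
      (∑ σ : Fin 2, μ σ) * ((nh : ℝ) / (L : ℝ) ^ d - ν) := by rw [Finset.sum_mul]
  rw [hs] at hmain
  exact hmain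

end Window

/-! ### Lieb's theorem on the even torus in every dimension `d ≥ 1` -/

section Lieb

variable {d L : ℕ} [NeZero L]

/-- (Local to this section.) [folklore] -/
local instance (priority := high) instDecidableEqFermionTorusCorrAff' : DecidableEq (FermionTorus d L) :=
  LinearOrder.toDecidableEq

/-- **The two sublattices of the even torus are equinumerous, in every dimension `d ≥ 1`**: for even
`L` the staggering sign `ε_x = (-1)^{Σ xᵢ}` takes the value `+1` on exactly `L^d/2` sites (the unit
shift in the first coordinate is a sign-flipping injection; `d = 2`:
`LiebTwoHoppings.two_mul_card_filter_torusStagger_eq_one`). [cite: LiebPRL1989, Theorem 2 (`|A| = |B|`)] -/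
theorem LiebHalfFilled.two_mul_card_filter_torusStagger_eq_one_pow (hd : 0 < d) (hL : Even L) :
    2 * (univ.filter fun x : FermionTorus d L => torusStagger x = 1).card = L ^ d := by
  set A : Finset (FermionTorus d L) := univ.filter fun x : FermionTorus d L => torusStagger x = 1 with hA
  set i₀ : Fin d := ⟨0, hd⟩ with hi₀
  set s : FermionTorus d L → FermionTorus d L := fun x =>
    FermionTorus.ofTorusSite (FermionTorus.toTorusSite x + Pi.single i₀ 1) with hs
  have hts : ∀ x, FermionTorus.toTorusSite (s x) = FermionTorus.toTorusSite x + Pi.single i₀ 1 :=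
    fun x => FermionTorus.toTorusSite_ofTorusSite _
  have hs_inj : Function.Injective s := by
    intro x y h
    have h' := congrArg FermionTorus.toTorusSite h
    rw [hts, hts, add_left_inj] at h'
    exact (FermionTorus.equivTorusSite (d := d) (L := L)).injective h'
  have hflip : ∀ x, torusStagger (s x) = -torusStagger x := fun x =>
    torusStagger_eq_neg_of_toTorusSite_eq hL (hts x)
  have hmemA : ∀ x, x ∈ A ↔ torusStagger x = 1 := fun x => by
    rw [hA, mem_filter]
    exact ⟨fun h => h.2, fun h => ⟨mem_univ _, h⟩⟩
  have h1 : A.map ⟨s, hs_inj⟩ ⊆ Aᶜ := by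
    intro y hy
    rw [mem_map] at hy
    obtain ⟨x, hx, rfl⟩ := hy
    rw [mem_compl, hmemA]
    rw [hmemA] at hx
    change torusStagger (s x) ≠ 1
    rw [hflip, hx]
    exact Int.units_ne_iff_eq_neg.2 rfl
  have h2 : Aᶜ.map ⟨s, hs_inj⟩ ⊆ A := by
    intro y hy
    rw [mem_map] at hy
    obtain ⟨x, hx, rfl⟩ := hy
    rw [mem_compl, hmemA] at hx
    rw [hmemA]
    change torusStagger (s x) = 1
    rw [hflip, Int.units_ne_iff_eq_neg.1 hx, neg_neg]
  have c1 : A.card ≤ Aᶜ.card := by simpa using card_le_card h1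
  have c2 : Aᶜ.card ≤ A.card := by simpa using card_le_card h2
  have hsum : A.card + Aᶜ.card = L ^ d := by
    rw [card_add_card_compl, LangerMattis.card_fermionTorus_eq]
  omega

/-- **Lieb's hypotheses on the even torus `(ℤ/Lℤ)^d`, `d ≥ 1`**: the torus graph is connected,
`A = {x : ε_x = +1}` is a bipartition class, and `|Aᶜ| = |A|`. [cite: LiebPRL1989, Theorem 2] -/
theorem LiebHalfFilled.hubbardTorus_lieb_hypotheses_pow (hd : 0 < d) (hL : Even L) :
    (fermionTorusGraph d L).Connected ∧
      (∀ x y : FermionTorus d L, (fermionTorusGraph d L).Adj x y →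
        (x ∈ (univ.filter fun x : FermionTorus d L => torusStagger x = 1) ↔
          y ∉ (univ.filter fun x : FermionTorus d L => torusStagger x = 1))) ∧
      (univ.filter fun x : FermionTorus d L => torusStagger x = 1)ᶜ.card =
        (univ.filter fun x : FermionTorus d L => torusStagger x = 1).card := by
  set A : Finset (FermionTorus d L) := univ.filter fun x : FermionTorus d L => torusStagger x = 1 with hA
  have hmemA : ∀ x, x ∈ A ↔ torusStagger x = 1 := fun x => by
    rw [hA, mem_filter]
    exact ⟨fun h => h.2, fun h => ⟨mem_univ _, h⟩⟩
  have hAadj : ∀ x y : FermionTorus d L, (fermionTorusGraph d L).Adj x y → (x ∈ A ↔ y ∉ A) := by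
    intro x y hxy
    have h := torusStagger_eq_neg_of_adj_holds hL hxy
    rw [hmemA, hmemA, h]
    change -torusStagger y = 1 ↔ torusStagger y ≠ 1
    rw [Int.units_ne_iff_eq_neg, neg_eq_iff_eq_neg]
  have h2 := LiebHalfFilled.two_mul_card_filter_torusStagger_eq_one_pow (L := L) hd hL
  rw [← hA] at h2
  have hcompl : Aᶜ.card = A.card := by
    have := card_add_card_compl A
    rw [LangerMattis.card_fermionTorus_eq] at this
    omega
  exact ⟨LiebTwoHoppings.fermionTorusGraph_connected d L, hAadj, hcompl⟩

/-- **THE half-filled ground state of the even torus `(ℤ/Lℤ)^d`** (`d ≥ 1`, `L` even, `t ≠ 0`,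
`U > 0`): a unit vector `ψ ∈ szSector (L^d) 0` with `H ψ = E₀(L^d) ψ`; every `L^d`-particle ground
state is `⟨ψ, φ⟩ ψ`; and the tracial `L^d`-particle ground state is `O ↦ ⟨ψ, O ψ⟩`.
[cite: LiebPRL1989, Theorem 2] -/
theorem LiebHalfFilled.hubbardTorus_exists_unit_groundState_pow (hd : 0 < d) (hL : Even L) {t U : ℝ}
    (ht : t ≠ 0) (hU : 0 < U) :
    ∃ ψ ∈ szSector (L ^ d) 0, star ψ ⬝ᵥ ψ = 1 ∧
      hamiltonian (fermionTorusGraph d L) t U *ᵥ ψ =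
        ((groundEnergyAt (fermionTorusGraph d L) t U (L ^ d) : ℝ) : ℂ) • ψ ∧
      (∀ φ : Fock (Orb (FermionTorus d L)), IsNParticle (L ^ d) φ →
        hamiltonian (fermionTorusGraph d L) t U *ᵥ φ =
          ((groundEnergyAt (fermionTorusGraph d L) t U (L ^ d) : ℝ) : ℂ) • φ →
          φ = (star ψ ⬝ᵥ φ) • ψ) ∧
      (hamiltonian (fermionTorusGraph d L) t U).sectorGroundProj (szSector (L ^ d) 0) =
        (hamiltonian (fermionTorusGraph d L) t U).sectorGroundProj
          (nParticleSubmodule (ι := Orb (FermionTorus d L)) (L ^ d)) ∧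
      ∀ O : Matrix (Finset (Orb (FermionTorus d L))) (Finset (Orb (FermionTorus d L))) ℂ,
        ((hamiltonian (fermionTorusGraph d L) t U).sectorGroundProj
            (nParticleSubmodule (ι := Orb (FermionTorus d L)) (L ^ d))).projState O =
          star ψ ⬝ᵥ O *ᵥ ψ := by
  obtain ⟨hG, hA, hcard⟩ := LiebHalfFilled.hubbardTorus_lieb_hypotheses_pow (L := L) hd hL
  have h := LiebHalfFilled.exists_unit_groundState hG _ hA hcard ht hU
  have hP := LiebHalfFilled.sectorGroundProj_szSector_eq hG _ hA hcard ht hU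
  rw [LangerMattis.card_fermionTorus_eq] at h hP
  obtain ⟨ψ, hψK, hψ1, hHψ, -, huniq, hstate⟩ := h
  exact ⟨ψ, hψK, hψ1, hHψ, huniq, hP, hstate⟩

/-- **At half filling on the even torus `(ℤ/Lℤ)^d` the tracial central-sector ground state is THE
ground state** (`d ≥ 1`): for every normalised `L^d`-particle ground state `φ`,
`⟨φ, O φ⟩ = ω_P(O)` with `P` the ground projection of the sector `(L^d, S^z = 0)`, formed with ANY
decidability instance. [cite: LiebPRL1989, Theorem 2] -/
theorem LiebHalfFilled.hubbardTorus_groundState_expect_eq_projState_pow (hd : 0 < d) (hL : Even L)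
    {t U : ℝ} (ht : t ≠ 0) (hU : 0 < U)
    {instD : DecidableEq (Finset (Orb (FermionTorus d L)))}
    {φ : Fock (Orb (FermionTorus d L))} (hφ : IsGroundState (hamiltonian (fermionTorusGraph d L) t U) (L ^ d) φ)
    (hφ1 : star φ ⬝ᵥ φ = 1) (O : Matrix (Finset (Orb (FermionTorus d L))) (Finset (Orb (FermionTorus d L))) ℂ) :
    star φ ⬝ᵥ O *ᵥ φ =
      (@Matrix.sectorGroundProj _ _ instD (hubbardTorus d L t U) (szSector (L ^ d) 0)).projState O := by
  show _ = (@Matrix.sectorGroundProj _ _ instD (hamiltonian (fermionTorusGraph d L) t U) (szSector (L ^ d) 0)).projState O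
  obtain ⟨ψ, -, hψ1, -, huniq, hPeq, hstate⟩ :=
    LiebHalfFilled.hubbardTorus_exists_unit_groundState_pow (L := L) hd hL ht hU
  obtain ⟨hN, -, hHφ⟩ := hφ
  have hφeq : φ = (star ψ ⬝ᵥ φ) • ψ := huniq φ hN hHφ
  set cφ : ℂ := star ψ ⬝ᵥ φ with hcφ
  have hcc : star cφ * cφ = 1 := by
    have h := hφ1
    rw [hφeq, star_smul, smul_dotProduct, dotProduct_smul, hψ1, smul_eq_mul, smul_eq_mul, mul_one] at h
    exact h
  have hval : star φ ⬝ᵥ O *ᵥ φ = star ψ ⬝ᵥ O *ᵥ ψ := by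
    rw [hφeq, star_smul, mulVec_smul, smul_dotProduct, dotProduct_smul, smul_eq_mul, smul_eq_mul,
      ← mul_assoc, hcc, one_mul]
  rw [hval, ← hstate O, ← hPeq]
  congr!

/-- `2n = L^d` ⇒ `n / L^d = 1/2` (real form). [folklore] -/
private theorem half_of_two_mul_eq_pow {d L nh : ℕ} [NeZero L] (hnh : 2 * nh = L ^ d) :
    (nh : ℝ) / (L : ℝ) ^ d = 1 / 2 := by
  have hL : (0 : ℝ) < (L : ℝ) ^ d := by
    have : (0 : ℝ) < L := by exact_mod_cast Nat.pos_of_ne_zero (NeZero.ne L)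
    positivity
  have h : (2 : ℝ) * nh = (L : ℝ) ^ d := by exact_mod_cast hnh
  rw [div_eq_iff hL.ne']
  linarith

/-- For even `L`, `L^d` is even when `d ≥ 1`: `2 · (L^d / 2) = L^d`. [folklore] -/
private theorem two_mul_pow_div_two {d L : ℕ} (hd : 0 < d) (hL : Even L) : 2 * (L ^ d / 2) = L ^ d := by
  obtain ⟨k, hk⟩ := hL
  obtain ⟨e, rfl⟩ : ∃ e, d = e + 1 := ⟨d - 1, by omega⟩
  have h2 : L ^ (e + 1) = 2 * (k * L ^ e) := by rw [pow_succ, hk]; ring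
  rw [h2, Nat.mul_div_cancel_left _ two_pos]

/-- **Window certificate with an energy constraint (affine reductions) ⇒ correlator of THE
half-filled ground state of every large even torus `(ℤ/Lℤ)^d`** (`d ≥ 1`): under the data of
`re_projState_ge_of_window_certificate_aff_ineq`, for even `L ≥ 3` with `x ↦ x mod L` injective on
`thicken Λ' 1`, `t ≠ 0`, `U > 0`, and every normalised `L^d`-particle ground state `φ`:
`c − Σₖ ‖aₖ‖ + (Σ_σ μ_σ)(1/2 − ν) + κ (u − groundEnergyAt (fermionTorusGraph d L) t U (L^d)/L^d)
   ≤ Re ⟨φ, Γ(ι_{Λ',L}) X φ⟩`. [cite: WangEtAl2024, §III] -/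
theorem groundState_re_expect_ge_of_window_certificate_aff_ineq (hd : 0 < d) (hLe : Even L)
    (hL : 3 ≤ L) {t U : ℝ} (ht : t ≠ 0) (hU : 0 < U)
    {Λ Λ' : Finset (Site d)} (hΛ : Λ ⊆ Λ')
    (hclosed : ∀ x ∈ Λ, ∀ i : Fin d, x + unitVec i ∈ Λ' ∧ x - unitVec i ∈ Λ')
    (h0 : thicken ({0} : Finset (Site d)) 1 ⊆ Λ') (hz : (0 : Site d) ∈ Λ')
    (hInj : Set.InjOn (Torus.proj (d := d) L) ↑(thicken Λ' 1))
    (hInj' : Set.InjOn (Torus.proj (d := d) L) ↑Λ')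
    (Xw : FermionOp Λ') (κ u : ℝ) (μ : Fin 2 → ℝ) (ν : ℝ)
    {m : Type*} [Fintype m] [DecidableEq m] {Λm : Matrix m m ℂ} (hΛm : Λm.PosSemidef)
    (O : m → FermionOp Λ')
    {κ' : Type*} (s : Finset κ') (B : κ' → FermionOp Λ)
    {ι : Type*} (tt : Finset ι) (ε : ι → ℤˣ) (vv : ι → Site d) (hsh : ∀ l, affShiftSet (ε l) (vv l) Λ ⊆ Λ')
    (Y : ι → FermionOp Λ)
    {ρ : Type*} (uu : Finset ρ) (b : ρ → ℂ) (cw : ρ → List (Orb (PolySite Λ') × Bool))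
    (hcw : ∀ j ∈ uu, ladderCharge (cw j) ≠ 0 ∨ ladderSpinCharge (cw j) ≠ 0)
    {δ : Type*} (ah : Finset δ) (dc : δ → ℝ) (V : δ → FermionOp Λ')
    {κ'' : Type*} (w : Finset κ'') (a : κ'' → ℂ) (word : κ'' → List (Orb (PolySite Λ') × Bool)) {c : ℝ}
    (hcert : Xw - (c : ℂ) • (1 : FermionOp Λ') -
        ∑ σ : Fin 2, ((μ σ : ℝ) : ℂ) • (nAt 0 hz σ - ((ν : ℝ) : ℂ) • (1 : FermionOp Λ')) -
        ((κ : ℝ) : ℂ) • (((u : ℝ) : ℂ) • (1 : FermionOp Λ') -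
          fermionEmbed (PolySite.incl h0) ((hubbardFermionInteraction d t U).meanEnergyObs 1)) =
      gramForm Λm O +
        (∑ k ∈ s, ((hubbardFermionInteraction d t U).localHamiltonian Λ' * fermionEmbed (PolySite.incl hΛ) (B k) -
            fermionEmbed (PolySite.incl hΛ) (B k) * (hubbardFermionInteraction d t U).localHamiltonian Λ') +
          ∑ l ∈ tt, (fermionEmbed (PolySite.incl (hsh l)) (fermionEmbed (PolySite.affEmb (ε l) (vv l) Λ) (Y l)) -
            fermionEmbed (PolySite.incl hΛ) (Y l)) +
          ∑ j ∈ uu, b j • ladderWord (cw j)) +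
        (∑ m' ∈ ah, ((dc m' : ℝ) : ℂ) • ((V m')ᴴ - V m') + ∑ k ∈ w, a k • ladderWord (word k)))
    {φ : Fock (Orb (FermionTorus d L))} (hφ : IsGroundState (hamiltonian (fermionTorusGraph d L) t U) (L ^ d) φ)
    (hφ1 : star φ ⬝ᵥ φ = 1) :
    c - ∑ k ∈ w, ‖a k‖ + (∑ σ : Fin 2, μ σ) * (1 / 2 - ν) +
        κ * (u - groundEnergyAt (fermionTorusGraph d L) t U (L ^ d) / (L : ℝ) ^ d) ≤
      (star φ ⬝ᵥ fermionEmbed (PolySite.toTorusEmb L hInj') Xw *ᵥ φ).re := by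
  set nh : ℕ := L ^ d / 2 with hnhdef
  have hnh : 2 * nh = L ^ d := two_mul_pow_div_two hd hLe
  have hn : nh ≤ Fintype.card (FermionTorus d L) := by
    rw [LangerMattis.card_fermionTorus_eq]
    omega
  have h := re_projState_ge_of_window_certificate_aff_ineq t U hL hn hΛ hclosed h0 hz hInj hInj' Xw κ u μ ν
    hΛm O s B tt ε vv hsh Y uu b cw hcw ah dc V w a word hcert
  rw [hnh, half_of_two_mul_eq_pow hnh,
    ← LiebHalfFilled.hubbardTorus_groundState_expect_eq_projState_pow hd hLe ht hU hφ hφ1] at h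
  exact h

/-- **Translation-averaged form** (every `d ≥ 1`): the same bound for
`Re (torusAvgExpectAt L Λ' X φ)`, `φ` any normalised half-filled ground state of the even torus,
since every translate `U_v φ` is again one. [cite: WangEtAl2024, §III] -/
theorem groundState_re_torusAvgExpectAt_ge_of_window_certificate_aff_ineq (hd : 0 < d) (hLe : Even L)
    (hL : 3 ≤ L) {t U : ℝ} (ht : t ≠ 0) (hU : 0 < U)
    {Λ Λ' : Finset (Site d)} (hΛ : Λ ⊆ Λ')
    (hclosed : ∀ x ∈ Λ, ∀ i : Fin d, x + unitVec i ∈ Λ' ∧ x - unitVec i ∈ Λ')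
    (h0 : thicken ({0} : Finset (Site d)) 1 ⊆ Λ') (hz : (0 : Site d) ∈ Λ')
    (hInj : Set.InjOn (Torus.proj (d := d) L) ↑(thicken Λ' 1))
    (Xw : FermionOp Λ') (κ u : ℝ) (μ : Fin 2 → ℝ) (ν : ℝ)
    {m : Type*} [Fintype m] [DecidableEq m] {Λm : Matrix m m ℂ} (hΛm : Λm.PosSemidef)
    (O : m → FermionOp Λ')
    {κ' : Type*} (s : Finset κ') (B : κ' → FermionOp Λ)
    {ι : Type*} (tt : Finset ι) (ε : ι → ℤˣ) (vv : ι → Site d) (hsh : ∀ l, affShiftSet (ε l) (vv l) Λ ⊆ Λ')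
    (Y : ι → FermionOp Λ)
    {ρ : Type*} (uu : Finset ρ) (b : ρ → ℂ) (cw : ρ → List (Orb (PolySite Λ') × Bool))
    (hcw : ∀ j ∈ uu, ladderCharge (cw j) ≠ 0 ∨ ladderSpinCharge (cw j) ≠ 0)
    {δ : Type*} (ah : Finset δ) (dc : δ → ℝ) (V : δ → FermionOp Λ')
    {κ'' : Type*} (w : Finset κ'') (a : κ'' → ℂ) (word : κ'' → List (Orb (PolySite Λ') × Bool)) {c : ℝ}
    (hcert : Xw - (c : ℂ) • (1 : FermionOp Λ') -
        ∑ σ : Fin 2, ((μ σ : ℝ) : ℂ) • (nAt 0 hz σ - ((ν : ℝ) : ℂ) • (1 : FermionOp Λ')) -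
        ((κ : ℝ) : ℂ) • (((u : ℝ) : ℂ) • (1 : FermionOp Λ') -
          fermionEmbed (PolySite.incl h0) ((hubbardFermionInteraction d t U).meanEnergyObs 1)) =
      gramForm Λm O +
        (∑ k ∈ s, ((hubbardFermionInteraction d t U).localHamiltonian Λ' * fermionEmbed (PolySite.incl hΛ) (B k) -
            fermionEmbed (PolySite.incl hΛ) (B k) * (hubbardFermionInteraction d t U).localHamiltonian Λ') +
          ∑ l ∈ tt, (fermionEmbed (PolySite.incl (hsh l)) (fermionEmbed (PolySite.affEmb (ε l) (vv l) Λ) (Y l)) -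
            fermionEmbed (PolySite.incl hΛ) (Y l)) +
          ∑ j ∈ uu, b j • ladderWord (cw j)) +
        (∑ m' ∈ ah, ((dc m' : ℝ) : ℂ) • ((V m')ᴴ - V m') + ∑ k ∈ w, a k • ladderWord (word k)))
    {φ : Fock (Orb (FermionTorus d L))} (hφ : IsGroundState (hamiltonian (fermionTorusGraph d L) t U) (L ^ d) φ)
    (hφ1 : star φ ⬝ᵥ φ = 1) :
    c - ∑ k ∈ w, ‖a k‖ + (∑ σ : Fin 2, μ σ) * (1 / 2 - ν) +
        κ * (u - groundEnergyAt (fermionTorusGraph d L) t U (L ^ d) / (L : ℝ) ^ d) ≤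
      (torusAvgExpectAt L Λ' Xw φ).re := by
  have hInj' : Set.InjOn (Torus.proj (d := d) L) ↑Λ' := hInj.mono (by exact_mod_cast subset_thicken Λ' 1)
  set bnd : ℝ := c - ∑ k ∈ w, ‖a k‖ + (∑ σ : Fin 2, μ σ) * (1 / 2 - ν) +
    κ * (u - groundEnergyAt (fermionTorusGraph d L) t U (L ^ d) / (L : ℝ) ^ d) with hbnd
  have hterm : ∀ v : TorusSite d L, bnd ≤
      (expect (fermionEmbed (PolySite.toTorusEmb L hInj') Xw) ((fockTranslate v).val *ᵥ φ)).re := fun v =>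
    groundState_re_expect_ge_of_window_certificate_aff_ineq hd hLe hL ht hU hΛ hclosed h0 hz hInj hInj' Xw κ u μ ν
      hΛm O s B tt ε vv hsh Y uu b cw hcw ah dc V w a word hcert (isGroundState_fockTranslate_mulVec t U v hφ)
      (by rw [star_dotProduct_fockTranslate_mulVec, hφ1])
  rw [torusAvgExpectAt_of_injOn L hInj' Xw φ, card_torusSite, ← Complex.ofReal_natCast,
    ← Complex.ofReal_inv, Complex.re_ofReal_mul, Complex.re_sum]
  have hLpos : (0 : ℝ) < ((L ^ d : ℕ) : ℝ) := by
    have : 0 < L := Nat.pos_of_ne_zero (NeZero.ne L)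
    positivity
  have hsum : ((L ^ d : ℕ) : ℝ) * bnd ≤
      ∑ v : TorusSite d L, (expect (fermionEmbed (PolySite.toTorusEmb L hInj') Xw) ((fockTranslate v).val *ᵥ φ)).re := by
    have h := Finset.card_nsmul_le_sum (Finset.univ : Finset (TorusSite d L)) _ bnd fun v _ => hterm v
    rw [Finset.card_univ, card_torusSite, nsmul_eq_mul] at h
    exact h
  rw [← inv_mul_le_iff₀ (inv_pos.2 hLpos), inv_inv]
  exact hsum

end Lieb

/-! ### The thermodynamic limit for the half-filled Hubbard chain -/

section Chain

open Filter _root_.Topology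

/-- **Certified correlator bounds for infinite-volume ground states of the half-filled Hubbard
CHAIN.** Let `ω` be a torus-limit state of normalised half-filled ground states `ψ_L` (`N = L`) of
the rings `fermionTorusGraph 1 L` along even `L → ∞` (`t ≠ 0`, `U > 0`), and suppose the
thermodynamic-limit energy density of the chain satisfies the certified upper bound
`hubbardChainEnergyDensity t U ≤ u`. Then a chain window certificate with energy constraint
`(κ ≥ 0, u)` for the objective `X ∈ 𝔄_{Λ'}` (data of `re_projState_ge_of_window_certificate_aff_ineq`,
`d = 1`: translations and reflections) proves `c − Σₖ ‖aₖ‖ + (Σ_σ μ_σ)(1/2 − ν) ≤ Re ω(X)` — the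
statement of the bundle's one-dimensional correlator rows (format `certsdp/1` §7; e.g. the double
occupancy of the half-filled chain, compared with the exact Lieb–Wu derivative `de/dU`).
[cite: WangEtAl2024, §III] -/
theorem InfVolFermionState.IsTorusLimitOf.re_expect_ge_of_chain_window_certificate_ineq
    {t U : ℝ} (ht : t ≠ 0) (hU : 0 < U) {κ u : ℝ} (hκ : 0 ≤ κ)
    (hu : ThermodynamicLimit.hubbardChainEnergyDensity t U ≤ u)
    {Λ Λ' : Finset (Site 1)} (hΛ : Λ ⊆ Λ')
    (hclosed : ∀ x ∈ Λ, ∀ i : Fin 1, x + unitVec i ∈ Λ' ∧ x - unitVec i ∈ Λ')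
    (h0 : thicken ({0} : Finset (Site 1)) 1 ⊆ Λ') (hz : (0 : Site 1) ∈ Λ')
    (Xw : FermionOp Λ') (μ : Fin 2 → ℝ) (ν : ℝ)
    {m : Type*} [Fintype m] [DecidableEq m] {Λm : Matrix m m ℂ} (hΛm : Λm.PosSemidef)
    (O : m → FermionOp Λ')
    {κ' : Type*} (s : Finset κ') (B : κ' → FermionOp Λ)
    {ι : Type*} (tt : Finset ι) (ε : ι → ℤˣ) (vv : ι → Site 1) (hsh : ∀ l, affShiftSet (ε l) (vv l) Λ ⊆ Λ')
    (Y : ι → FermionOp Λ)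
    {ρ : Type*} (uu : Finset ρ) (b : ρ → ℂ) (cw : ρ → List (Orb (PolySite Λ') × Bool))
    (hcw : ∀ j ∈ uu, ladderCharge (cw j) ≠ 0 ∨ ladderSpinCharge (cw j) ≠ 0)
    {δ : Type*} (ah : Finset δ) (dc : δ → ℝ) (V : δ → FermionOp Λ')
    {κ'' : Type*} (w : Finset κ'') (a : κ'' → ℂ) (word : κ'' → List (Orb (PolySite Λ') × Bool)) {c : ℝ}
    (hcert : Xw - (c : ℂ) • (1 : FermionOp Λ') -
        ∑ σ : Fin 2, ((μ σ : ℝ) : ℂ) • (nAt 0 hz σ - ((ν : ℝ) : ℂ) • (1 : FermionOp Λ')) -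
        ((κ : ℝ) : ℂ) • (((u : ℝ) : ℂ) • (1 : FermionOp Λ') -
          fermionEmbed (PolySite.incl h0) ((hubbardFermionInteraction 1 t U).meanEnergyObs 1)) =
      gramForm Λm O +
        (∑ k ∈ s, ((hubbardFermionInteraction 1 t U).localHamiltonian Λ' * fermionEmbed (PolySite.incl hΛ) (B k) -
            fermionEmbed (PolySite.incl hΛ) (B k) * (hubbardFermionInteraction 1 t U).localHamiltonian Λ') +
          ∑ l ∈ tt, (fermionEmbed (PolySite.incl (hsh l)) (fermionEmbed (PolySite.affEmb (ε l) (vv l) Λ) (Y l)) -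
            fermionEmbed (PolySite.incl hΛ) (Y l)) +
          ∑ j ∈ uu, b j • ladderWord (cw j)) +
        (∑ m' ∈ ah, ((dc m' : ℝ) : ℂ) • ((V m')ᴴ - V m') + ∑ k ∈ w, a k • ladderWord (word k)))
    {Ls : ℕ → ℕ} (hLs : Tendsto Ls atTop atTop) (hev : ∀ j, Even (Ls j))
    {ψ : ∀ L, Fock (Orb (FermionTorus 1 L))}
    (hψ : ∀ j, _root_.Literature.MathematicalPhysics.QuantumLattice.IsGroundState
      (hamiltonian (fermionTorusGraph 1 (Ls j)) t U) (Ls j) (ψ (Ls j)))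
    (hψ1 : ∀ j, star (ψ (Ls j)) ⬝ᵥ ψ (Ls j) = 1)
    {ω : InfVolFermionState 1} (hω : ω.IsTorusLimitOf ψ Ls) :
    c - ∑ k ∈ w, ‖a k‖ + (∑ σ : Fin 2, μ σ) * (1 / 2 - ν) ≤ (ω.expect Λ' Xw).re := by
  -- the averaged torus expectations converge to `ω(X)`
  have hlim : Tendsto (fun j => (torusAvgExpect (Ls j) Λ' Xw (ψ (Ls j))).re) atTop
      (𝓝 (ω.expect Λ' Xw).re) :=
    (Complex.continuous_re.tendsto _).comp (hω Λ' Xw)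
  -- the energies per site converge to the thermodynamic-limit density of the chain
  have hE : Tendsto (fun j => groundEnergyAt (fermionTorusGraph 1 (Ls j)) t U (Ls j) / ((Ls j : ℕ) : ℝ))
      atTop (𝓝 (ThermodynamicLimit.hubbardChainEnergyDensity t U)) := by
    have h := (ThermodynamicLimit.tendsto_hubbardChainEnergyDensity t hU.le).comp hLs
    refine h.congr fun j => ?_
    simp only [Function.comp_apply, ThermodynamicLimit.energyPerSite_fermionTorusGraph_one]
  set b0 : ℝ := c - ∑ k ∈ w, ‖a k‖ + (∑ σ : Fin 2, μ σ) * (1 / 2 - ν) with hb0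
  have hbnd : Tendsto (fun j => b0 + κ * (u - groundEnergyAt (fermionTorusGraph 1 (Ls j)) t U (Ls j) /
      ((Ls j : ℕ) : ℝ))) atTop (𝓝 (b0 + κ * (u - ThermodynamicLimit.hubbardChainEnergyDensity t U))) :=
    tendsto_const_nhds.add ((tendsto_const_nhds.sub hE).const_mul κ)
  -- the finite-ring inequality holds for all large `j`
  obtain ⟨L₀, hL₀⟩ := exists_forall_le_injOn_proj (thicken Λ' 1)
  have hev' : ∀ᶠ j in atTop, b0 + κ * (u - groundEnergyAt (fermionTorusGraph 1 (Ls j)) t U (Ls j) /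
      ((Ls j : ℕ) : ℝ)) ≤ (torusAvgExpect (Ls j) Λ' Xw (ψ (Ls j))).re := by
    filter_upwards [hLs.eventually (eventually_ge_atTop (max L₀ 3))] with j hj
    have hL3 : 3 ≤ Ls j := le_trans (le_max_right _ _) hj
    have hLL : L₀ ≤ Ls j := le_trans (le_max_left _ _) hj
    haveI : NeZero (Ls j) := ⟨by omega⟩
    rw [torusAvgExpect_eq]
    have h := groundState_re_torusAvgExpectAt_ge_of_window_certificate_aff_ineq (d := 1) one_pos (hev j) hL3 ht hU
      hΛ hclosed h0 hz (hL₀ (Ls j) hLL) Xw κ u μ ν hΛm O s B tt ε vv hsh Y uu b cw hcw ah dc V w a word hcert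
      (φ := ψ (Ls j)) (by simpa only [pow_one] using hψ j) (hψ1 j)
    simpa only [pow_one] using h
  have hle := le_of_tendsto_of_tendsto hbnd hlim hev'
  have hslack : 0 ≤ κ * (u - ThermodynamicLimit.hubbardChainEnergyDensity t U) :=
    mul_nonneg hκ (sub_nonneg.2 hu)
  linarith

/-- **Torus-limit half-filled ground states of the chain (and of every `(ℤ/Lℤ)^d`, `d ≥ 1`) exist.**
[cite: BratteliRobinsonII1997, §6.2.4] -/
theorem LiebHalfFilled.exists_isTorusLimitOf_groundState_pow {d : ℕ} (hd : 0 < d) {t U : ℝ} (ht : t ≠ 0)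
    (hU : 0 < U) :
    ∃ (Ls : ℕ → ℕ) (ψ : ∀ L, Fock (Orb (FermionTorus d L))) (ω : InfVolFermionState d),
      Tendsto Ls atTop atTop ∧ (∀ j, Even (Ls j)) ∧
      (∀ j, IsGroundState (hamiltonian (fermionTorusGraph d (Ls j)) t U) (Ls j ^ d) (ψ (Ls j))) ∧
      (∀ j, star (ψ (Ls j)) ⬝ᵥ ψ (Ls j) = 1) ∧ ω.IsTorusLimitOf ψ Ls := by
  classical
  have hex : ∀ L : ℕ, ∃ φ : Fock (Orb (FermionTorus d L)), (Even L ∧ L ≠ 0) →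
      IsGroundState (hamiltonian (fermionTorusGraph d L) t U) (L ^ d) φ ∧ star φ ⬝ᵥ φ = 1 := by
    intro L
    by_cases h : Even L ∧ L ≠ 0
    · haveI : NeZero L := ⟨h.2⟩
      obtain ⟨φ, hφK, hφ1, hHφ, -, -, -⟩ :=
        LiebHalfFilled.hubbardTorus_exists_unit_groundState_pow (L := L) hd h.1 ht hU
      have hN : IsNParticle (L ^ d) φ := ((mem_szSector_iff _ _ φ).1 hφK).1
      have hφ0 : φ ≠ 0 := by
        intro h0
        rw [h0, star_zero, zero_dotProduct] at hφ1
        exact zero_ne_one hφ1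
      exact ⟨φ, fun _ => ⟨⟨hN, hφ0, hHφ⟩, hφ1⟩⟩
    · exact ⟨0, fun h' => absurd h' h⟩
  choose ψ hψ using hex
  set Ls₀ : ℕ → ℕ := fun j => 2 * (j + 1) with hLs₀
  have hLs₀t : Tendsto Ls₀ atTop atTop :=
    tendsto_atTop_atTop.2 fun b => ⟨b, fun j hj => by simp only [hLs₀]; omega⟩
  have hev : ∀ j, Even (Ls₀ j) ∧ Ls₀ j ≠ 0 := fun j =>
    ⟨by simp only [hLs₀]; exact even_two_mul _, by simp only [hLs₀]; omega⟩
  obtain ⟨φ, hφ, ω, hω⟩ :=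
    InfVolFermionState.exists_isTorusLimitOf_subseq ψ hLs₀t (fun j => (hψ _ (hev j)).2)
  exact ⟨Ls₀ ∘ φ, ψ, ω, hLs₀t.comp hφ.tendsto_atTop, fun j => (hev (φ j)).1,
    fun j => (hψ _ (hev (φ j))).1, fun j => (hψ _ (hev (φ j))).2, hω⟩

/-! ### The energy hypothesis is a statement about the limit state itself -/

/-- **Torus-limit half-filled ground states of the square lattice carry the thermodynamic energy
density**: for `ω` a torus limit of normalised `L²`-particle ground states along even `L → ∞`
(`U ≥ 0`), `ω.hubbardEnergyDensity t U = energyDensity2D t U 1`. Hence the hypothesis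
`energyDensity2D t U 1 ≤ u` of
`InfVolFermionState.IsTorusLimitOf.re_expect_ge_of_window_certificate_d4_ineq` is the certificate's
inequality hypothesis `ω(h₀) ≤ u` (format `certsdp/1` §7) for the state `ω` itself; and by the
variational principle (`IsTranslationInvariant.energyDensity2D_le_hubbardEnergyDensity`) such `ω`
minimise the energy density among translation-invariant states of density `1`. (The
`IsGroundStateInSector` form is `IsTorusLimitOf.hubbardEnergyDensity_eq_energyDensity2D`.)
[cite: BratteliRobinsonII1997, §6.2.4] -/
theorem InfVolFermionState.IsTorusLimitOf.hubbardEnergyDensity_eq_energyDensity2D_of_isGroundState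
    {ω : InfVolFermionState 2} {ψ : ∀ L, Fock (Orb (FermionTorus 2 L))} {Ls : ℕ → ℕ}
    (h : ω.IsTorusLimitOf ψ Ls) (hLs : Tendsto Ls atTop atTop) (hev : ∀ j, Even (Ls j))
    (t : ℝ) {U : ℝ} (hU : 0 ≤ U)
    (hψ : ∀ j, _root_.Literature.MathematicalPhysics.QuantumLattice.IsGroundState
      (hamiltonian (fermionTorusGraph 2 (Ls j)) t U) (Ls j ^ 2) (ψ (Ls j)))
    (h1 : ∀ j, star (ψ (Ls j)) ⬝ᵥ ψ (Ls j) = 1) :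
    ω.hubbardEnergyDensity t U = ThermodynamicLimit.energyDensity2D t U 1 := by
  refine h.hubbardEnergyDensity_eq t U hLs ?_
  have hlim := (ThermodynamicLimit.tendsto_energyDensity2D_torus t hU zero_le_one one_lt_two).comp hLs
  refine hlim.congr fun j => ?_
  obtain ⟨-, -, hH⟩ := hψ j
  simp only [Function.comp_apply, HartreeFock.rectN_one_of_even (hev j)]
  rw [hubbardTorus, hH, dotProduct_smul, h1, smul_eq_mul, mul_one, Complex.ofReal_re]
  rfl

/-- **Torus-limit half-filled ground states of the chain carry the chain's thermodynamic energy
density**: `ω.hubbardEnergyDensity t U = hubbardChainEnergyDensity t U` for `ω` a torus limit of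
normalised `L`-particle ground states of the rings `ℤ/Lℤ` along `L → ∞` (`U ≥ 0`); so the hypothesis
`hubbardChainEnergyDensity t U ≤ u` of
`InfVolFermionState.IsTorusLimitOf.re_expect_ge_of_chain_window_certificate_ineq` is `ω(h₀) ≤ u` for
`ω` itself. [cite: BratteliRobinsonII1997, §6.2.4] -/
theorem InfVolFermionState.IsTorusLimitOf.hubbardEnergyDensity_eq_hubbardChainEnergyDensity
    {ω : InfVolFermionState 1} {ψ : ∀ L, Fock (Orb (FermionTorus 1 L))} {Ls : ℕ → ℕ}
    (h : ω.IsTorusLimitOf ψ Ls) (hLs : Tendsto Ls atTop atTop) (t : ℝ) {U : ℝ} (hU : 0 ≤ U)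
    (hψ : ∀ j, _root_.Literature.MathematicalPhysics.QuantumLattice.IsGroundState
      (hamiltonian (fermionTorusGraph 1 (Ls j)) t U) (Ls j) (ψ (Ls j)))
    (h1 : ∀ j, star (ψ (Ls j)) ⬝ᵥ ψ (Ls j) = 1) :
    ω.hubbardEnergyDensity t U = ThermodynamicLimit.hubbardChainEnergyDensity t U := by
  refine h.hubbardEnergyDensity_eq t U hLs ?_
  have hlim := (ThermodynamicLimit.tendsto_hubbardChainEnergyDensity t hU).comp hLs
  refine hlim.congr fun j => ?_
  obtain ⟨-, -, hH⟩ := hψ j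
  simp only [Function.comp_apply, ThermodynamicLimit.energyPerSite_fermionTorusGraph_one, pow_one]
  rw [hubbardTorus, hH, dotProduct_smul, h1, smul_eq_mul, mul_one, Complex.ofReal_re]
  rfl

end Chain

/-! ### Double occupancy ↔ slope of the energy density: the chain, and monotonicity in `U` -/

section DoubleOccupancySlope

open Filter _root_.Topology

/-- **Supergradient inequality for the half-filled chain in the thermodynamic limit.** `U, U' ≥ 0`:
if `ψ_m` are normalised half-filled (`N = L_m`) ground states of `H(t,U)` on the rings `ℤ/L_mℤ`,
`L_m → ∞`, whose double-occupancy densities `⟨ψ_m, D ψ_m⟩/L_m` converge to `D∞`, then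
`e_chain(t,U') − e_chain(t,U) ≤ (U' − U)·D∞` — the chain analogue of
`DoubleOccupancy.energyDensity2D_sub_le_mul_of_tendsto`
(`DoubleOccupancy.groundEnergyAt_sub_le_mul_doubleOcc` on every ring, divided by `L`, and
`ThermodynamicLimit.tendsto_hubbardChainEnergyDensity`). [cite: KomaTasaki1994, §1] -/
theorem DoubleOccupancy.hubbardChainEnergyDensity_sub_le_mul_of_tendsto (t : ℝ) {U U' : ℝ}
    (hU : 0 ≤ U) (hU' : 0 ≤ U') {φ : ℕ → ℕ} (hφ : Tendsto φ atTop atTop)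
    {ψ : ∀ m : ℕ, Fock (Orb (FermionTorus 1 (φ m)))}
    (hψ : ∀ m, _root_.Literature.MathematicalPhysics.QuantumLattice.IsGroundState
      (hamiltonian (fermionTorusGraph 1 (φ m)) t U) (φ m) (ψ m))
    (hψ1 : ∀ m, star (ψ m) ⬝ᵥ ψ m = 1) {D : ℝ}
    (hD : Tendsto (fun m => (expect (∑ x : FermionTorus 1 (φ m), numberOp x 0 * numberOp x 1)
      (ψ m)).re / ((φ m : ℕ) : ℝ)) atTop (𝓝 D)) :
    ThermodynamicLimit.hubbardChainEnergyDensity t U' -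
        ThermodynamicLimit.hubbardChainEnergyDensity t U ≤ (U' - U) * D := by
  have limU := (ThermodynamicLimit.tendsto_hubbardChainEnergyDensity t hU).comp hφ
  have limU' := (ThermodynamicLimit.tendsto_hubbardChainEnergyDensity t hU').comp hφ
  refine le_of_tendsto_of_tendsto' (limU'.sub limU) (hD.const_mul (U' - U)) fun m => ?_
  simp only [Function.comp_apply, ThermodynamicLimit.energyPerSite_fermionTorusGraph_one]
  have h := DoubleOccupancy.groundEnergyAt_sub_le_mul_doubleOcc (fermionTorusGraph 1 (φ m)) t U U'
    (hψ m) (hψ1 m)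
  have hL : (0 : ℝ) ≤ ((φ m : ℕ) : ℝ) := Nat.cast_nonneg _
  rw [← sub_div, ← mul_div_assoc]
  exact div_le_div_of_nonneg_right h hL

/-- **The local double occupancy of a torus-limit ground state of the half-filled chain is a
supergradient of `U ↦ e_chain(t,U)`**: `e_chain(t,U') − e_chain(t,U) ≤ (U' − U)·Re ω(n_{0↑}n_{0↓})`
for every `U' ≥ 0` (`DoubleOccupancy.hubbardChainEnergyDensity_sub_le_mul_of_tendsto` with
`D∞ = Re ω(n_{0↑}n_{0↓})`, by `torusAvgExpect_docc`). So a certified interval for `ω(n_{0↑}n_{0↓})`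
(the chain correlator rows, `IsTorusLimitOf.re_expect_ge_of_chain_window_certificate_ineq`) bounds
the one-sided `U`-derivatives of the concave chain energy density, and conversely.
[cite: KomaTasaki1994, §1] -/
theorem InfVolFermionState.IsTorusLimitOf.hubbardChainEnergyDensity_sub_le_mul_re_expect_docc
    {ω : InfVolFermionState 1} {ψ : ∀ L, Fock (Orb (FermionTorus 1 L))} {Ls : ℕ → ℕ}
    (h : ω.IsTorusLimitOf ψ Ls) (hLs : Tendsto Ls atTop atTop) (t : ℝ) {U U' : ℝ} (hU : 0 ≤ U)
    (hU' : 0 ≤ U')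
    (hψ : ∀ j, _root_.Literature.MathematicalPhysics.QuantumLattice.IsGroundState
      (hamiltonian (fermionTorusGraph 1 (Ls j)) t U) (Ls j) (ψ (Ls j)))
    (h1 : ∀ j, star (ψ (Ls j)) ⬝ᵥ ψ (Ls j) = 1) :
    ThermodynamicLimit.hubbardChainEnergyDensity t U' -
        ThermodynamicLimit.hubbardChainEnergyDensity t U ≤
      (U' - U) * (ω.expect ({0} : Finset (Site 1))
        (nAt 0 (Finset.mem_singleton_self 0) 0 * nAt 0 (Finset.mem_singleton_self 0) 1)).re := by
  set V : FermionOp ({0} : Finset (Site 1)) :=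
    nAt 0 (Finset.mem_singleton_self 0) 0 * nAt 0 (Finset.mem_singleton_self 0) 1 with hV
  have hlim : Tendsto (fun j => (torusAvgExpect (Ls j) ({0} : Finset (Site 1)) V (ψ (Ls j))).re)
      atTop (𝓝 (ω.expect ({0} : Finset (Site 1)) V).re) :=
    (Complex.continuous_re.tendsto _).comp (h _ V)
  have hD : Tendsto (fun j => (_root_.Literature.MathematicalPhysics.QuantumLattice.expect
      (∑ x : FermionTorus 1 (Ls j), numberOp x 0 * numberOp x 1)
      (ψ (Ls j))).re / ((Ls j : ℕ) : ℝ)) atTop (𝓝 (ω.expect ({0} : Finset (Site 1)) V).re) := by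
    refine hlim.congr' ?_
    filter_upwards [hLs.eventually_ge_atTop 1] with j hj
    haveI : NeZero (Ls j) := ⟨Nat.one_le_iff_ne_zero.1 hj⟩
    rw [hV, torusAvgExpect_docc, pow_one, ← Complex.ofReal_natCast, ← Complex.ofReal_inv,
      Complex.re_ofReal_mul, inv_mul_eq_div]
  exact DoubleOccupancy.hubbardChainEnergyDensity_sub_le_mul_of_tendsto t hU hU' hLs
    (ψ := fun j => ψ (Ls j)) hψ h1 hD

/-- **The double occupancy of torus-limit ground states is non-increasing in `U`** (square
lattice, `0 ≤ n < 2`): if `ω₁`, `ω₂` are torus limits of normalised ground states in the sectors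
`N_L(n)` at couplings `0 ≤ U₁ < U₂` (along possibly different sequences of tori), then
`Re ω₂(n_{0↑}n_{0↓}) ≤ Re ω₁(n_{0↑}n_{0↓})`: add the two supergradient inequalities
`e(U₂) − e(U₁) ≤ (U₂ − U₁)·D_{ω₁}` and `e(U₁) − e(U₂) ≤ (U₁ − U₂)·D_{ω₂}`
(`IsTorusLimitOf.energyDensity2D_sub_le_mul_re_expect_docc`). Hence a certified LOWER bound on the
double occupancy at `U₂` is one at every `U₁ < U₂`, and a certified UPPER bound at `U₁` is one at
every `U₂ > U₁` (monotonicity of the supergradients of the concave `U ↦ e(t,U,n)`).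
[cite: KomaTasaki1994, §1] -/
theorem InfVolFermionState.IsTorusLimitOf.re_expect_docc_anti
    {ω₁ ω₂ : InfVolFermionState 2} {ψ₁ ψ₂ : ∀ L, Fock (Orb (FermionTorus 2 L))} {Ls₁ Ls₂ : ℕ → ℕ}
    (h₁ : ω₁.IsTorusLimitOf ψ₁ Ls₁) (h₂ : ω₂.IsTorusLimitOf ψ₂ Ls₂)
    (hLs₁ : Tendsto Ls₁ atTop atTop) (hLs₂ : Tendsto Ls₂ atTop atTop) (t : ℝ) {U₁ U₂ : ℝ}
    (hU₁ : 0 ≤ U₁) (hU : U₁ < U₂) {n : ℝ} (hn0 : 0 ≤ n) (hn2 : n < 2)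
    (hψ₁ : ∀ j, _root_.Literature.MathematicalPhysics.QuantumLattice.IsGroundState
      (hamiltonian (fermionTorusGraph 2 (Ls₁ j)) t U₁) (ThermodynamicLimit.rectN n (Ls₁ j))
      (ψ₁ (Ls₁ j)))
    (h1₁ : ∀ j, star (ψ₁ (Ls₁ j)) ⬝ᵥ ψ₁ (Ls₁ j) = 1)
    (hψ₂ : ∀ j, _root_.Literature.MathematicalPhysics.QuantumLattice.IsGroundState
      (hamiltonian (fermionTorusGraph 2 (Ls₂ j)) t U₂) (ThermodynamicLimit.rectN n (Ls₂ j))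
      (ψ₂ (Ls₂ j)))
    (h1₂ : ∀ j, star (ψ₂ (Ls₂ j)) ⬝ᵥ ψ₂ (Ls₂ j) = 1) :
    (ω₂.expect ({0} : Finset (Site 2))
        (nAt 0 (Finset.mem_singleton_self 0) 0 * nAt 0 (Finset.mem_singleton_self 0) 1)).re ≤
      (ω₁.expect ({0} : Finset (Site 2))
        (nAt 0 (Finset.mem_singleton_self 0) 0 * nAt 0 (Finset.mem_singleton_self 0) 1)).re := by
  have hU₂ : 0 ≤ U₂ := hU₁.trans hU.le
  have hA := h₁.energyDensity2D_sub_le_mul_re_expect_docc hLs₁ t hU₁ hU₂ hn0 hn2 hψ₁ h1₁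
  have hB := h₂.energyDensity2D_sub_le_mul_re_expect_docc hLs₂ t hU₂ hU₁ hn0 hn2 hψ₂ h1₂
  by_contra hlt
  push Not at hlt
  nlinarith [mul_pos (sub_pos.2 hU) (sub_pos.2 hlt)]

/-- The half-filled, even-`L` form of `IsTorusLimitOf.re_expect_docc_anti` (ground states with
`N = L²`, the family of the bundle's square-lattice correlator rows): for torus-limit half-filled
ground states `ω₁` at `U₁` and `ω₂` at `U₂`, `0 ≤ U₁ < U₂`, `Re ω₂(n_{0↑}n_{0↓}) ≤ Re ω₁(n_{0↑}n_{0↓})`.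
[cite: KomaTasaki1994, §1] -/
theorem InfVolFermionState.IsTorusLimitOf.re_expect_docc_anti_halfFilled
    {ω₁ ω₂ : InfVolFermionState 2} {ψ₁ ψ₂ : ∀ L, Fock (Orb (FermionTorus 2 L))} {Ls₁ Ls₂ : ℕ → ℕ}
    (h₁ : ω₁.IsTorusLimitOf ψ₁ Ls₁) (h₂ : ω₂.IsTorusLimitOf ψ₂ Ls₂)
    (hLs₁ : Tendsto Ls₁ atTop atTop) (hLs₂ : Tendsto Ls₂ atTop atTop)
    (hev₁ : ∀ j, Even (Ls₁ j)) (hev₂ : ∀ j, Even (Ls₂ j)) (t : ℝ) {U₁ U₂ : ℝ}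
    (hU₁ : 0 ≤ U₁) (hU : U₁ < U₂)
    (hψ₁ : ∀ j, _root_.Literature.MathematicalPhysics.QuantumLattice.IsGroundState
      (hamiltonian (fermionTorusGraph 2 (Ls₁ j)) t U₁) (Ls₁ j ^ 2) (ψ₁ (Ls₁ j)))
    (h1₁ : ∀ j, star (ψ₁ (Ls₁ j)) ⬝ᵥ ψ₁ (Ls₁ j) = 1)
    (hψ₂ : ∀ j, _root_.Literature.MathematicalPhysics.QuantumLattice.IsGroundState
      (hamiltonian (fermionTorusGraph 2 (Ls₂ j)) t U₂) (Ls₂ j ^ 2) (ψ₂ (Ls₂ j)))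
    (h1₂ : ∀ j, star (ψ₂ (Ls₂ j)) ⬝ᵥ ψ₂ (Ls₂ j) = 1) :
    (ω₂.expect ({0} : Finset (Site 2))
        (nAt 0 (Finset.mem_singleton_self 0) 0 * nAt 0 (Finset.mem_singleton_self 0) 1)).re ≤
      (ω₁.expect ({0} : Finset (Site 2))
        (nAt 0 (Finset.mem_singleton_self 0) 0 * nAt 0 (Finset.mem_singleton_self 0) 1)).re :=
  h₁.re_expect_docc_anti h₂ hLs₁ hLs₂ t hU₁ hU zero_le_one one_lt_two
    (fun j => by rw [HartreeFock.rectN_one_of_even (hev₁ j)]; exact hψ₁ j) h1₁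
    (fun j => by rw [HartreeFock.rectN_one_of_even (hev₂ j)]; exact hψ₂ j) h1₂

/-- **The double occupancy of torus-limit ground states of the half-filled chain is non-increasing
in `U`**: for torus-limit half-filled (`N = L`) ground states `ω₁` at `U₁` and `ω₂` at `U₂` of the
rings `ℤ/Lℤ`, `0 ≤ U₁ < U₂`, `Re ω₂(n_{0↑}n_{0↓}) ≤ Re ω₁(n_{0↑}n_{0↓})`
(`IsTorusLimitOf.hubbardChainEnergyDensity_sub_le_mul_re_expect_docc` twice). [cite: KomaTasaki1994, §1] -/
theorem InfVolFermionState.IsTorusLimitOf.re_expect_docc_anti_chain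
    {ω₁ ω₂ : InfVolFermionState 1} {ψ₁ ψ₂ : ∀ L, Fock (Orb (FermionTorus 1 L))} {Ls₁ Ls₂ : ℕ → ℕ}
    (h₁ : ω₁.IsTorusLimitOf ψ₁ Ls₁) (h₂ : ω₂.IsTorusLimitOf ψ₂ Ls₂)
    (hLs₁ : Tendsto Ls₁ atTop atTop) (hLs₂ : Tendsto Ls₂ atTop atTop) (t : ℝ) {U₁ U₂ : ℝ}
    (hU₁ : 0 ≤ U₁) (hU : U₁ < U₂)
    (hψ₁ : ∀ j, _root_.Literature.MathematicalPhysics.QuantumLattice.IsGroundState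
      (hamiltonian (fermionTorusGraph 1 (Ls₁ j)) t U₁) (Ls₁ j) (ψ₁ (Ls₁ j)))
    (h1₁ : ∀ j, star (ψ₁ (Ls₁ j)) ⬝ᵥ ψ₁ (Ls₁ j) = 1)
    (hψ₂ : ∀ j, _root_.Literature.MathematicalPhysics.QuantumLattice.IsGroundState
      (hamiltonian (fermionTorusGraph 1 (Ls₂ j)) t U₂) (Ls₂ j) (ψ₂ (Ls₂ j)))
    (h1₂ : ∀ j, star (ψ₂ (Ls₂ j)) ⬝ᵥ ψ₂ (Ls₂ j) = 1) :
    (ω₂.expect ({0} : Finset (Site 1))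
        (nAt 0 (Finset.mem_singleton_self 0) 0 * nAt 0 (Finset.mem_singleton_self 0) 1)).re ≤
      (ω₁.expect ({0} : Finset (Site 1))
        (nAt 0 (Finset.mem_singleton_self 0) 0 * nAt 0 (Finset.mem_singleton_self 0) 1)).re := by
  have hU₂ : 0 ≤ U₂ := hU₁.trans hU.le
  have hA := h₁.hubbardChainEnergyDensity_sub_le_mul_re_expect_docc hLs₁ t hU₁ hU₂ hψ₁ h1₁
  have hB := h₂.hubbardChainEnergyDensity_sub_le_mul_re_expect_docc hLs₂ t hU₂ hU₁ hψ₂ h1₂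
  by_contra hlt
  push Not at hlt
  nlinarith [mul_pos (sub_pos.2 hU) (sub_pos.2 hlt)]

end DoubleOccupancySlope

end Literature.MathematicalPhysics.QuantumLattice
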